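import Summits.QuantumFields.YangMills.Theorems.FluctuationComparisonRegPrIntLOrganTangentWeightLipOfChartLetters
import Summits.QuantumFields.YangMills.Theorems.FluctuationComparisonRegPrIntLOrganTangentLogDensitySegLipOfBeta
import HarnessLib

/-!
# Crux `FluctuationComparisonRegPrIntL` (stmt-QuantumFields-20520, rung R3), PATH-B organ, H-currency cone — (L42b) «SEGMENT EDITION, WEIGHT SIDE»: (W-Lip) of ✓(L38) from
# (Φ-disp-Lip) + (J-Lip) + the SEGMENT form of (logρ∕logρ′-Lip); and END-TO-END from the ROW'S OWN (β) (both densities) + LOCAL bondwise chart increments — no coupling of the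
# chart speed to the (β) radius

Cell `ym3-torus` (YM ladder rung R3 = continuum `SU(2)` Yang–Mills on the three-torus — a RUNG: NOT d = 4, NOT infinite volume, NOT a mass gap, NOT Clay).
Width seat `ym-ust-20520-w5` (gen 25), `--kind proof --supports stmt-QuantumFields-20520 --as helper`, count-neutral, DEFINITION-FREE, default heartbeats,
no registry ∕ binder ∕ `Lines/` edit.  Over ✓p822554 `…WeightLipOfChartLetters` (`lipschitzOnWith_mwCut_comp`, `exists_abs_log_le_of_plaq_le`, `lipschitzOnWith_rpowFactor`,
`mwCut_mem_Icc`), ✓p822480 v1.1 `…LipschitzProductTools` (`lipschitzOnWith_mul_of_support_seg`, `lipschitzOnWith_mul_of_bound`), ✓(L42a) `…LogDensitySegLipOfBeta`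
(`logDensity_segLip_of_beta`).

WHY.  The support product rule needs the density factor `ρ^t·ρ′^{1−t}∘Φ` Lipschitz only between support points of the cut JOINED BY AN IN-SUPPORT PARAMETER SEGMENT (between two
components of the support the cut vanishes somewhere, and the product splits there — ✓`lipschitzOnWith_mul_of_support_seg`).  So (logρ-Lip) may be asked in SEGMENT form, and in
that form it follows from (β) + LOCAL increments (✓(L42a)), with smallness rows «`k_e·δ ≤ μ`» that a small locality radius `δ` makes vacuous.

WHAT.  §1 `rpowFactor_pos_le` (pointwise: `0 < ρ^t·ρ′^{1−t} ≤ e^{ML+ML′}` on the closed `24∕25·θ_Ts`-window), ★★`lipschitzOnWith_wNum_of_chartLetters_seg` (= ✓`lipschitzOnWith_wNum_of_chartLetters`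
with (logρ-Lip)(logρ′-Lip) in SEGMENT form on a CONVEX parameter set; same explicit modulus).  §2 ★★★`weightLip_of_chartLetters_seg`: `∃ bW, ∀ t ∈ [0,1]`, BOTH (W-Lip) clauses of ✓p822302
VERBATIM from (Φ-disp-Lip) + (logρ∕logρ′-Lip-seg) + (J-Lip) along near relational paths and square edges.  §3 ★★★`weightLip_of_beta_of_chartLetters`: the same FROM THE ROW'S OWN (β) TEXTS
for `ρ_Ts` AND `ρ′_Ts` (run-prefix binders at level `Ts`, bounds `Bρ`, `Bρ′`) + (Φ-disp-Lip) + (J-Lip) + LOCAL bondwise increments (Φ-bond-incr-loc) along near paths and square edges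
(speeds `k ≥ 0`, `Σ k ≤ K`, locality `δ > 0`, rows `k e·δ ≤ μ`, `4·(√3·μ) ≤ θ_Ts∕50`, `μ < rA·(49∕50·θ_Ts)`).  NET, BY KERNEL: REG′ ×4 (✓p822302) ⟸ (β)×2 [row prefix] + {(Φ-disp-Lip)
(= ✓p823035 `hdisp` re-based at n = Ts ∕ NEW `hdisp_n` below), (Φ-bond-incr-loc) = `Dlink`, (J-Lip)} + frame.

HONEST FRAMING: [folklore] calculus over HYPOTHESIS letters; (β) is a run-prefix HYPOTHESIS, the chart letters are D0∕(P1) material — nothing here constructs Bałaban's chart; nothing of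
Bałaban's analysis is asserted or proved; KER′, (I-curv), (I-cov), `hdisp`, `hdisp_n` untouched and OPEN; `OrganDischargeInputsHJ(sq)` ∕ `SpreadFibreLawH(J)(sq)` UNDISCHARGED; the five
registered stubs of `Lines/semiclassical_s2beta.lean`, crux 20520 and `YM3TorusSU2` are NOT proved; registry untouched; rung R3 = SU(2) YM₃ on T³ at fixed lattice data — NOT d = 4, NOT
infinite volume, NOT a mass gap, NOT Clay; the Yang–Mills mass gap is NOT proved.  [folklore]
-/

set_option autoImplicit false

noncomputable section

namespace Summit.QuantumFields.YangMills.Theorems.OrganTangentWeightLipOfChartLettersSeg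

open MeasureTheory Filter Topology Set Function
open scoped ENNReal NNReal BigOperators
open Literature.MathematicalPhysics.QuantumFieldTheory.Balaban1983to89 T3ContinuumYM3Torus T3NestedUnitLaws T3UnitLawDensityEML T4Continuum BalabanUVClass
  T3UnitScaleTilt T3LevelShift T3TiltDescent
open T4CubeChartExp (expPt)
open Summit.QuantumFields.YangMills.Theorems.FluctuationComparisonRegPrIntLRunpairOrganFibreLaw (mwCut wNum)
open Summit.QuantumFields.YangMills.Theorems.OrganTangentLipschitzProductTools
open Summit.QuantumFields.YangMills.Theorems.OrganTangentWeightLipOfChartLetters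
open Summit.QuantumFields.YangMills.Theorems.OrganTangentLogDensitySegLipOfBeta (logDensity_segLip_of_beta)

/-! ## §1 The weight along a coarse curve: segment edition -/

section Weight

variable (F : T3Family) (γ b₀ p₀ : ℝ) (j Ts : ℕ)

/-- Pointwise: on the closed `24∕25·θ_Ts`-window the interpolated density factor is positive and `≤ e^{ML+ML′}` (`t ∈ [0,1]`). [folklore] -/
theorem rpowFactor_pos_le (ρ ρ' : (i : ℕ) → GaugeField (F.P i) 0 ↥(Matrix.specialUnitaryGroup (Fin 2) ℂ) → ℝ)
    (hpos : ∀ U, PlaqSmall (θBal F.L γ b₀ p₀ Ts) U → 0 < ρ Ts U ∧ 0 < ρ' Ts U) (hθ : 0 < θBal F.L γ b₀ p₀ Ts)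
    (ML ML' : ℝ) (hML : ∀ U, (∀ p, dist1 (GaugeField.plaqHol U p) ≤ 24 / 25 * θBal F.L γ b₀ p₀ Ts) → |Real.log (ρ Ts U)| ≤ ML)
    (hML' : ∀ U, (∀ p, dist1 (GaugeField.plaqHol U p) ≤ 24 / 25 * θBal F.L γ b₀ p₀ Ts) → |Real.log (ρ' Ts U)| ≤ ML')
    (t : ℝ) (ht0 : 0 ≤ t) (ht1 : t ≤ 1) (U : GaugeField (F.P Ts) 0 ↥(Matrix.specialUnitaryGroup (Fin 2) ℂ)) (hU : PlaqSmall (24 / 25 * θBal F.L γ b₀ p₀ Ts) U) :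
    0 < Real.rpow (ρ Ts U) t * Real.rpow (ρ' Ts U) (1 - t) ∧ Real.rpow (ρ Ts U) t * Real.rpow (ρ' Ts U) (1 - t) ≤ Real.exp (ML + ML') := by
  have h := lipschitzOnWith_rpowFactor F γ b₀ p₀ Ts ρ ρ' hpos hθ ML ML' hML hML' (fun _ => U) {0} (fun _ _ => hU) 0 0
    ((LipschitzWith.const (Real.log (ρ Ts U))).lipschitzOnWith.weaken (le_refl _))
    ((LipschitzWith.const (Real.log (ρ' Ts U))).lipschitzOnWith.weaken (le_refl _)) t ht0 ht1
  exact h.2 0 rfl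

/-- ★★ **THE INTERPOLATED WEIGHT ALONG A COARSE CURVE, SEGMENT EDITION** — ✓`lipschitzOnWith_wNum_of_chartLetters` with the density letters asked only between parameters joined by a
segment INSIDE the sub-window set: for a CONVEX `I`, (Φ-disp-Lip) `D` on `I`, (J-Lip) `KJ` on `I`, and (logρ-Lip-seg)(logρ′-Lip-seg)
`∀ x y ∈ I, (∀ r ∈ uIcc x y, PlaqSmall (24∕25·θ_Ts) (Φ (C r, z))) → |log ρ_Ts (Φ (C x, z)) − log ρ_Ts (Φ (C y, z))| ≤ Kρ·|x − y|` ⟹ `s ↦ wNum_t (C s) z` is Lipschitz on `I` with the same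
explicit modulus as the plain edition. [folklore] -/
theorem lipschitzOnWith_wNum_of_chartLetters_seg (hjTs : j + 1 ≤ Ts)
    (ρ ρ' : (i : ℕ) → GaugeField (F.P i) 0 ↥(Matrix.specialUnitaryGroup (Fin 2) ℂ) → ℝ)
    (hpos : ∀ U, PlaqSmall (θBal F.L γ b₀ p₀ Ts) U → 0 < ρ Ts U ∧ 0 < ρ' Ts U) (hθ : ∀ n, 0 < θBal F.L γ b₀ p₀ n)
    (ML ML' : ℝ) (hML : ∀ U, (∀ p, dist1 (GaugeField.plaqHol U p) ≤ 24 / 25 * θBal F.L γ b₀ p₀ Ts) → |Real.log (ρ Ts U)| ≤ ML)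
    (hML' : ∀ U, (∀ p, dist1 (GaugeField.plaqHol U p) ≤ 24 / 25 * θBal F.L γ b₀ p₀ Ts) → |Real.log (ρ' Ts U)| ≤ ML')
    (hχsupp : ∀ U, mwCut F γ b₀ p₀ j Ts U ≠ 0 → ∀ (n : ℕ) (hjn : j + 1 ≤ n) (hnK : n ≤ Ts), PlaqSmall (24 / 25 * θBal F.L γ b₀ p₀ n) (descendTo F ℰp n Ts hnK U))
    {Z : Type} (Φ : GaugeField (F.P j) 0 ↥(Matrix.specialUnitaryGroup (Fin 2) ℂ) × Z → GaugeField (F.P Ts) 0 ↥(Matrix.specialUnitaryGroup (Fin 2) ℂ))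
    (J : GaugeField (F.P j) 0 ↥(Matrix.specialUnitaryGroup (Fin 2) ℂ) × Z → ℝ≥0) (CJ : ℝ) (hJle : ∀ V z, (J (V, z) : ℝ) ≤ CJ)
    (t : ℝ) (ht0 : 0 ≤ t) (ht1 : t ≤ 1) (D Kρ Kρ' KJ : ℝ≥0)
    (C : ℝ → GaugeField (F.P j) 0 ↥(Matrix.specialUnitaryGroup (Fin 2) ℂ)) (z : Z) (I : Set ℝ) (hI : Convex ℝ I)
    (hdisp : ∀ (n : ℕ) (hjn : j + 1 ≤ n) (hnT : n ≤ Ts) (p : Plaq (F.P n) 0),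
      LipschitzOnWith D (fun s => dist1 (GaugeField.plaqHol (descendTo F ℰp n Ts hnT (Φ (C s, z))) p)) I)
    (hLρ : ∀ x ∈ I, ∀ y ∈ I, (∀ r ∈ Set.uIcc x y, PlaqSmall (24 / 25 * θBal F.L γ b₀ p₀ Ts) (Φ (C r, z))) →
      |Real.log (ρ Ts (Φ (C x, z))) - Real.log (ρ Ts (Φ (C y, z)))| ≤ Kρ * |x - y|)
    (hLρ' : ∀ x ∈ I, ∀ y ∈ I, (∀ r ∈ Set.uIcc x y, PlaqSmall (24 / 25 * θBal F.L γ b₀ p₀ Ts) (Φ (C r, z))) →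
      |Real.log (ρ' Ts (Φ (C x, z))) - Real.log (ρ' Ts (Φ (C y, z)))| ≤ Kρ' * |x - y|)
    (hLJ : LipschitzOnWith KJ (fun s => (J (C s, z) : ℝ)) I) :
    LipschitzOnWith (((∑ i ∈ Finset.range (Ts - j), ∑ _p : Plaq (F.P (j + 1 + i)) 0, Real.toNNReal (1 / ((24 / 25 - 1 / 2) * θBal F.L γ b₀ p₀ (j + 1 + i))) * D)
        * Real.toNNReal (Real.exp (ML + ML')) + Real.toNNReal 1 * (Real.toNNReal (Real.exp (ML + ML')) * (Kρ + Kρ'))) * Real.toNNReal CJ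
        + Real.toNNReal (Real.exp (ML + ML')) * KJ)
      (fun s => wNum F γ b₀ p₀ j Ts ρ ρ' Φ J t (C s) z) I := by
  -- where the cut is non-zero the curve is in the sub-window
  have hsupp : ∀ s, mwCut F γ b₀ p₀ j Ts (Φ (C s, z)) ≠ 0 → PlaqSmall (24 / 25 * θBal F.L γ b₀ p₀ Ts) (Φ (C s, z)) := by
    intro s hχ q
    have h := hχsupp _ hχ Ts hjTs le_rfl q
    rw [T3DescentFibreTower.descendTo_self] at h
    exact h
  have hA := lipschitzOnWith_mwCut_comp F γ b₀ p₀ j Ts hθ D (fun s => Φ (C s, z)) I hdisp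
  have hB0 : 0 ≤ Real.exp (ML + ML') := (Real.exp_pos _).le
  -- the density factor between support points joined by an in-support segment
  have hRseg : ∀ x ∈ I, ∀ y ∈ I, (∀ r ∈ Set.uIcc x y, mwCut F γ b₀ p₀ j Ts (Φ (C r, z)) ≠ 0) →
      |Real.rpow (ρ Ts (Φ (C x, z))) t * Real.rpow (ρ' Ts (Φ (C x, z))) (1 - t) - Real.rpow (ρ Ts (Φ (C y, z))) t * Real.rpow (ρ' Ts (Φ (C y, z))) (1 - t)|
        ≤ (Real.toNNReal (Real.exp (ML + ML')) * (Kρ + Kρ') : ℝ≥0) * |x - y| := by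
    intro x hx y hy hseg
    set S' : Set ℝ := I ∩ Set.uIcc x y with hS'
    have hS'win : ∀ s ∈ S', PlaqSmall (24 / 25 * θBal F.L γ b₀ p₀ Ts) (Φ (C s, z)) := fun s hs => hsupp s (hseg s hs.2)
    have hsub : ∀ a ∈ S', ∀ b ∈ S', ∀ r ∈ Set.uIcc a b, PlaqSmall (24 / 25 * θBal F.L γ b₀ p₀ Ts) (Φ (C r, z)) :=
      fun a ha b hb r hr => hsupp r (hseg r (Set.uIcc_subset_uIcc ha.2 hb.2 hr))
    have hL1 : LipschitzOnWith Kρ (fun s => Real.log (ρ Ts (Φ (C s, z)))) S' :=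
      LipschitzOnWith.of_dist_le_mul fun a ha b hb => by rw [Real.dist_eq, Real.dist_eq]; exact hLρ a ha.1 b hb.1 (hsub a ha b hb)
    have hL2 : LipschitzOnWith Kρ' (fun s => Real.log (ρ' Ts (Φ (C s, z)))) S' :=
      LipschitzOnWith.of_dist_le_mul fun a ha b hb => by rw [Real.dist_eq, Real.dist_eq]; exact hLρ' a ha.1 b hb.1 (hsub a ha b hb)
    obtain ⟨hR, -⟩ := lipschitzOnWith_rpowFactor F γ b₀ p₀ Ts ρ ρ' hpos (hθ Ts) ML ML' hML hML' (fun s => Φ (C s, z)) S' hS'win Kρ Kρ' hL1 hL2 t ht0 ht1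
    have h := (lipschitzOnWith_iff_dist_le_mul.1 hR) x ⟨hx, Set.left_mem_uIcc⟩ y ⟨hy, Set.right_mem_uIcc⟩
    rwa [Real.dist_eq, Real.dist_eq] at h
  -- pointwise bound on the support
  have hRb : ∀ s ∈ I, mwCut F γ b₀ p₀ j Ts (Φ (C s, z)) ≠ 0 →
      |Real.rpow (ρ Ts (Φ (C s, z))) t * Real.rpow (ρ' Ts (Φ (C s, z))) (1 - t)| ≤ Real.exp (ML + ML') := by
    intro s _ hχ
    have h := rpowFactor_pos_le F γ b₀ p₀ Ts ρ ρ' hpos (hθ Ts) ML ML' hML hML' t ht0 ht1 _ (hsupp s hχ)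
    rw [abs_of_pos h.1]; exact h.2
  -- cut × density factor, segment product rule
  have hAR := lipschitzOnWith_mul_of_support_seg (Mf := 1) (Mg := Real.exp (ML + ML')) hI hA
    (fun s _ => by rw [abs_of_nonneg (mwCut_mem_Icc F γ b₀ p₀ j Ts _).1]; exact (mwCut_mem_Icc F γ b₀ p₀ j Ts _).2)
    hRseg hRb zero_le_one hB0
  have hARb : ∀ s ∈ I, |mwCut F γ b₀ p₀ j Ts (Φ (C s, z)) * (Real.rpow (ρ Ts (Φ (C s, z))) t * Real.rpow (ρ' Ts (Φ (C s, z))) (1 - t))| ≤ Real.exp (ML + ML') := by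
    intro s hs
    by_cases hχ : mwCut F γ b₀ p₀ j Ts (Φ (C s, z)) = 0
    · rw [hχ, zero_mul, abs_zero]; exact hB0
    · rw [abs_mul, abs_of_nonneg (mwCut_mem_Icc F γ b₀ p₀ j Ts _).1]
      calc mwCut F γ b₀ p₀ j Ts (Φ (C s, z)) * |Real.rpow (ρ Ts (Φ (C s, z))) t * Real.rpow (ρ' Ts (Φ (C s, z))) (1 - t)|
          ≤ 1 * Real.exp (ML + ML') := mul_le_mul (mwCut_mem_Icc F γ b₀ p₀ j Ts _).2 (hRb s hs hχ) (abs_nonneg _) zero_le_one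
        _ = Real.exp (ML + ML') := one_mul _
  have hCJ0 : 0 ≤ CJ := (NNReal.coe_nonneg _).trans (hJle (C 0) z)
  have hJb : ∀ s ∈ I, |(J (C s, z) : ℝ)| ≤ CJ := fun s _ => by rw [abs_of_nonneg (NNReal.coe_nonneg _)]; exact hJle _ _
  have key := lipschitzOnWith_mul_of_bound hAR hARb hLJ hJb hB0 hCJ0
  refine lipschitzOnWith_iff_dist_le_mul.2 fun x hx y hy => ?_
  have h := lipschitzOnWith_iff_dist_le_mul.1 key x hx y hy
  simpa only [wNum] using h

end Weight

/-! ## §2 (W-Lip) — paths AND squares — from (Φ-disp-Lip) + (logρ∕logρ′-Lip-seg) + (J-Lip) -/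

section WLipSeg

/-- ★★★ **(W-Lip) FROM THE CHART-PRIMITIVE PATH LETTERS, SEGMENT EDITION** — as ✓`weightLip_of_chartLetters`, with the two density letters in SEGMENT form along each near relational path
and square edge (`∀ x y ∈ Ioo (-1) 2, (∀ r ∈ uIcc x y, PlaqSmall (24∕25·θ_Ts) (Φ (X r, z))) → |log ρ_Ts (Φ (X x, z)) − log ρ_Ts (Φ (X y, z))| ≤ Kρ·|x − y|`). [folklore] -/
theorem weightLip_of_chartLetters_seg (F : T3Family) (γ b₀ p₀ : ℝ) (j Ts : ℕ) (hjTs : j + 1 ≤ Ts)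
    (ρ ρ' : (i : ℕ) → GaugeField (F.P i) 0 ↥(Matrix.specialUnitaryGroup (Fin 2) ℂ) → ℝ)
    (hρc : ContinuousOn (ρ Ts) {U | PlaqSmall (θBal F.L γ b₀ p₀ Ts) U}) (hρ'c : ContinuousOn (ρ' Ts) {U | PlaqSmall (θBal F.L γ b₀ p₀ Ts) U})
    (hρpos : ∀ U, PlaqSmall (θBal F.L γ b₀ p₀ Ts) U → 0 < ρ Ts U ∧ 0 < ρ' Ts U) (hθ : ∀ n, 0 < θBal F.L γ b₀ p₀ n)
    (hχsupp : ∀ U, mwCut F γ b₀ p₀ j Ts U ≠ 0 → ∀ (n : ℕ) (hjn : j + 1 ≤ n) (hnK : n ≤ Ts), PlaqSmall (24 / 25 * θBal F.L γ b₀ p₀ n) (descendTo F ℰp n Ts hnK U))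
    {Z : Type} [MeasurableSpace Z] (τ : Measure Z)
    (Φ : GaugeField (F.P j) 0 ↥(Matrix.specialUnitaryGroup (Fin 2) ℂ) × Z → GaugeField (F.P Ts) 0 ↥(Matrix.specialUnitaryGroup (Fin 2) ℂ))
    (J : GaugeField (F.P j) 0 ↥(Matrix.specialUnitaryGroup (Fin 2) ℂ) × Z → ℝ≥0) (CJ : ℝ) (hJle : ∀ V z, (J (V, z) : ℝ) ≤ CJ)
    (rc : ℝ) (D Kρ Kρ' KJ : ℝ≥0)
    (hPdisp : ∀ (B' : PBond (F.P j) 0) (m' : Fin 3 → ℝ) (U₂ : GaugeField (F.P j) 0 ↥(Matrix.specialUnitaryGroup (Fin 2) ℂ))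
      (X : ℝ → GaugeField (F.P j) 0 ↥(Matrix.specialUnitaryGroup (Fin 2) ℂ)), ‖m'‖ ≤ rc * (θBal F.L γ b₀ p₀ j / 4) → PlaqSmall (θBal F.L γ b₀ p₀ j / 4) U₂ →
      (∀ s e, e ≠ B' → X s e = U₂ e) → (∀ s, X s B' = U₂ B' * expPt (s • m')) → ∀ (z : Z) (n : ℕ) (hjn : j + 1 ≤ n) (hnT : n ≤ Ts) (p : Plaq (F.P n) 0),
        LipschitzOnWith D (fun s => dist1 (GaugeField.plaqHol (descendTo F ℰp n Ts hnT (Φ (X s, z))) p)) (Set.Ioo (-1) 2))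
    (hPρ : ∀ (B' : PBond (F.P j) 0) (m' : Fin 3 → ℝ) (U₂ : GaugeField (F.P j) 0 ↥(Matrix.specialUnitaryGroup (Fin 2) ℂ))
      (X : ℝ → GaugeField (F.P j) 0 ↥(Matrix.specialUnitaryGroup (Fin 2) ℂ)), ‖m'‖ ≤ rc * (θBal F.L γ b₀ p₀ j / 4) → PlaqSmall (θBal F.L γ b₀ p₀ j / 4) U₂ →
      (∀ s e, e ≠ B' → X s e = U₂ e) → (∀ s, X s B' = U₂ B' * expPt (s • m')) → ∀ z : Z,
        (∀ x ∈ Set.Ioo (-1 : ℝ) 2, ∀ y ∈ Set.Ioo (-1 : ℝ) 2, (∀ r ∈ Set.uIcc x y, PlaqSmall (24 / 25 * θBal F.L γ b₀ p₀ Ts) (Φ (X r, z))) →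
          |Real.log (ρ Ts (Φ (X x, z))) - Real.log (ρ Ts (Φ (X y, z)))| ≤ Kρ * |x - y|) ∧
        (∀ x ∈ Set.Ioo (-1 : ℝ) 2, ∀ y ∈ Set.Ioo (-1 : ℝ) 2, (∀ r ∈ Set.uIcc x y, PlaqSmall (24 / 25 * θBal F.L γ b₀ p₀ Ts) (Φ (X r, z))) →
          |Real.log (ρ' Ts (Φ (X x, z))) - Real.log (ρ' Ts (Φ (X y, z)))| ≤ Kρ' * |x - y|))
    (hPJ : ∀ (B' : PBond (F.P j) 0) (m' : Fin 3 → ℝ) (U₂ : GaugeField (F.P j) 0 ↥(Matrix.specialUnitaryGroup (Fin 2) ℂ))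
      (X : ℝ → GaugeField (F.P j) 0 ↥(Matrix.specialUnitaryGroup (Fin 2) ℂ)), ‖m'‖ ≤ rc * (θBal F.L γ b₀ p₀ j / 4) → PlaqSmall (θBal F.L γ b₀ p₀ j / 4) U₂ →
      (∀ s e, e ≠ B' → X s e = U₂ e) → (∀ s, X s B' = U₂ B' * expPt (s • m')) → ∀ z : Z,
        LipschitzOnWith KJ (fun s => (J (X s, z) : ℝ)) (Set.Ioo (-1) 2))
    (hSdisp : ∀ (B B' : PBond (F.P j) 0) (m m' : Fin 3 → ℝ) (V00 : GaugeField (F.P j) 0 ↥(Matrix.specialUnitaryGroup (Fin 2) ℂ))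
      (Y : ℝ → GaugeField (F.P j) 0 ↥(Matrix.specialUnitaryGroup (Fin 2) ℂ)) (X : ℝ → ℝ → GaugeField (F.P j) 0 ↥(Matrix.specialUnitaryGroup (Fin 2) ℂ)),
      ‖m‖ ≤ rc * (θBal F.L γ b₀ p₀ j / 4) → ‖m'‖ ≤ rc * (θBal F.L γ b₀ p₀ j / 4) → PlaqSmall (θBal F.L γ b₀ p₀ j / 4) V00 →
      (∀ s e, e ≠ B → Y s e = V00 e) → (∀ s, Y s B = V00 B * expPt (s • m)) → (∀ s s' e, e ≠ B' → X s s' e = Y s e) → (∀ s s', X s s' B' = Y s B' * expPt (s' • m')) →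
      ∀ s' ∈ Set.Icc (0:ℝ) 1, ∀ (z : Z) (n : ℕ) (hjn : j + 1 ≤ n) (hnT : n ≤ Ts) (p : Plaq (F.P n) 0),
        LipschitzOnWith D (fun s => dist1 (GaugeField.plaqHol (descendTo F ℰp n Ts hnT (Φ (X s s', z))) p)) (Set.Ioo (-1) 2))
    (hSρ : ∀ (B B' : PBond (F.P j) 0) (m m' : Fin 3 → ℝ) (V00 : GaugeField (F.P j) 0 ↥(Matrix.specialUnitaryGroup (Fin 2) ℂ))
      (Y : ℝ → GaugeField (F.P j) 0 ↥(Matrix.specialUnitaryGroup (Fin 2) ℂ)) (X : ℝ → ℝ → GaugeField (F.P j) 0 ↥(Matrix.specialUnitaryGroup (Fin 2) ℂ)),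
      ‖m‖ ≤ rc * (θBal F.L γ b₀ p₀ j / 4) → ‖m'‖ ≤ rc * (θBal F.L γ b₀ p₀ j / 4) → PlaqSmall (θBal F.L γ b₀ p₀ j / 4) V00 →
      (∀ s e, e ≠ B → Y s e = V00 e) → (∀ s, Y s B = V00 B * expPt (s • m)) → (∀ s s' e, e ≠ B' → X s s' e = Y s e) → (∀ s s', X s s' B' = Y s B' * expPt (s' • m')) →
      ∀ s' ∈ Set.Icc (0:ℝ) 1, ∀ z : Z,
        (∀ x ∈ Set.Ioo (-1 : ℝ) 2, ∀ y ∈ Set.Ioo (-1 : ℝ) 2, (∀ r ∈ Set.uIcc x y, PlaqSmall (24 / 25 * θBal F.L γ b₀ p₀ Ts) (Φ (X r s', z))) →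
          |Real.log (ρ Ts (Φ (X x s', z))) - Real.log (ρ Ts (Φ (X y s', z)))| ≤ Kρ * |x - y|) ∧
        (∀ x ∈ Set.Ioo (-1 : ℝ) 2, ∀ y ∈ Set.Ioo (-1 : ℝ) 2, (∀ r ∈ Set.uIcc x y, PlaqSmall (24 / 25 * θBal F.L γ b₀ p₀ Ts) (Φ (X r s', z))) →
          |Real.log (ρ' Ts (Φ (X x s', z))) - Real.log (ρ' Ts (Φ (X y s', z)))| ≤ Kρ' * |x - y|))
    (hSJ : ∀ (B B' : PBond (F.P j) 0) (m m' : Fin 3 → ℝ) (V00 : GaugeField (F.P j) 0 ↥(Matrix.specialUnitaryGroup (Fin 2) ℂ))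
      (Y : ℝ → GaugeField (F.P j) 0 ↥(Matrix.specialUnitaryGroup (Fin 2) ℂ)) (X : ℝ → ℝ → GaugeField (F.P j) 0 ↥(Matrix.specialUnitaryGroup (Fin 2) ℂ)),
      ‖m‖ ≤ rc * (θBal F.L γ b₀ p₀ j / 4) → ‖m'‖ ≤ rc * (θBal F.L γ b₀ p₀ j / 4) → PlaqSmall (θBal F.L γ b₀ p₀ j / 4) V00 →
      (∀ s e, e ≠ B → Y s e = V00 e) → (∀ s, Y s B = V00 B * expPt (s • m)) → (∀ s s' e, e ≠ B' → X s s' e = Y s e) → (∀ s s', X s s' B' = Y s B' * expPt (s' • m')) →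
      ∀ s' ∈ Set.Icc (0:ℝ) 1, ∀ z : Z, LipschitzOnWith KJ (fun s => (J (X s s', z) : ℝ)) (Set.Ioo (-1) 2)) :
    ∃ bW : ℝ, ∀ t : ℝ, 0 ≤ t → t ≤ 1 →
      (∀ (B' : PBond (F.P j) 0) (m' : Fin 3 → ℝ) (U₂ : GaugeField (F.P j) 0 ↥(Matrix.specialUnitaryGroup (Fin 2) ℂ))
        (X : ℝ → GaugeField (F.P j) 0 ↥(Matrix.specialUnitaryGroup (Fin 2) ℂ)), ‖m'‖ ≤ rc * (θBal F.L γ b₀ p₀ j / 4) → PlaqSmall (θBal F.L γ b₀ p₀ j / 4) U₂ →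
        (∀ s e, e ≠ B' → X s e = U₂ e) → (∀ s, X s B' = U₂ B' * expPt (s • m')) →
        ∀ᵐ z ∂τ, LipschitzOnWith (Real.nnabs bW) (fun s => wNum F γ b₀ p₀ j Ts ρ ρ' Φ J t (X s) z) (Set.Ioo (-1) 2)) ∧
      (∀ (B B' : PBond (F.P j) 0) (m m' : Fin 3 → ℝ) (V00 : GaugeField (F.P j) 0 ↥(Matrix.specialUnitaryGroup (Fin 2) ℂ))
        (Y : ℝ → GaugeField (F.P j) 0 ↥(Matrix.specialUnitaryGroup (Fin 2) ℂ)) (X : ℝ → ℝ → GaugeField (F.P j) 0 ↥(Matrix.specialUnitaryGroup (Fin 2) ℂ)),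
        ‖m‖ ≤ rc * (θBal F.L γ b₀ p₀ j / 4) → ‖m'‖ ≤ rc * (θBal F.L γ b₀ p₀ j / 4) → PlaqSmall (θBal F.L γ b₀ p₀ j / 4) V00 →
        (∀ s e, e ≠ B → Y s e = V00 e) → (∀ s, Y s B = V00 B * expPt (s • m)) → (∀ s s' e, e ≠ B' → X s s' e = Y s e) → (∀ s s', X s s' B' = Y s B' * expPt (s' • m')) →
        ∀ s' ∈ Set.Icc (0:ℝ) 1, ∀ᵐ z ∂τ, LipschitzOnWith (Real.nnabs bW) (fun s => wNum F γ b₀ p₀ j Ts ρ ρ' Φ J t (X s s') z) (Set.Ioo (-1) 2)) := by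
  obtain ⟨ML, hML⟩ := exists_abs_log_le_of_plaq_le F γ b₀ p₀ Ts (ρ Ts) hρc (fun U hU => (hρpos U hU).1) (hθ Ts)
  obtain ⟨ML', hML'⟩ := exists_abs_log_le_of_plaq_le F γ b₀ p₀ Ts (ρ' Ts) hρ'c (fun U hU => (hρpos U hU).2) (hθ Ts)
  set K : ℝ≥0 := ((∑ i ∈ Finset.range (Ts - j), ∑ _p : Plaq (F.P (j + 1 + i)) 0, Real.toNNReal (1 / ((24 / 25 - 1 / 2) * θBal F.L γ b₀ p₀ (j + 1 + i))) * D)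
        * Real.toNNReal (Real.exp (ML + ML')) + Real.toNNReal 1 * (Real.toNNReal (Real.exp (ML + ML')) * (Kρ + Kρ'))) * Real.toNNReal CJ
        + Real.toNNReal (Real.exp (ML + ML')) * KJ with hKdef
  have hKabs : Real.nnabs (K : ℝ) = K := by ext; rw [Real.coe_nnabs, abs_of_nonneg (NNReal.coe_nonneg K)]
  refine ⟨(K : ℝ), fun t ht0 ht1 => ⟨?_, ?_⟩⟩
  · intro B' m' U₂ X hm' hU₂ hoff hon
    refine ae_of_all τ fun z => ?_
    rw [hKabs]
    obtain ⟨hLρ, hLρ'⟩ := hPρ B' m' U₂ X hm' hU₂ hoff hon z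
    exact lipschitzOnWith_wNum_of_chartLetters_seg F γ b₀ p₀ j Ts hjTs ρ ρ' hρpos hθ ML ML' hML hML' hχsupp Φ J CJ hJle t ht0 ht1 D Kρ Kρ' KJ X z
      (Set.Ioo (-1) 2) (convex_Ioo (-1 : ℝ) 2) (hPdisp B' m' U₂ X hm' hU₂ hoff hon z) hLρ hLρ' (hPJ B' m' U₂ X hm' hU₂ hoff hon z)
  · intro B B' m m' V00 Y X hm hm' hV hYoff hYon hXoff hXon s' hs'
    refine ae_of_all τ fun z => ?_
    rw [hKabs]
    obtain ⟨hLρ, hLρ'⟩ := hSρ B B' m m' V00 Y X hm hm' hV hYoff hYon hXoff hXon s' hs' z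
    exact lipschitzOnWith_wNum_of_chartLetters_seg F γ b₀ p₀ j Ts hjTs ρ ρ' hρpos hθ ML ML' hML hML' hχsupp Φ J CJ hJle t ht0 ht1 D Kρ Kρ' KJ (fun s => X s s') z
      (Set.Ioo (-1) 2) (convex_Ioo (-1 : ℝ) 2) (hSdisp B B' m m' V00 Y X hm hm' hV hYoff hYon hXoff hXon s' hs' z) hLρ hLρ' (hSJ B B' m m' V00 Y X hm hm' hV hYoff hYon hXoff hXon s' hs' z)

end WLipSeg

/-! ## §3 END-TO-END: (W-Lip) from the row's own (β) texts + (Φ-disp-Lip) + (J-Lip) + LOCAL bondwise chart increments -/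

section E2E

/-- ★★★ **(W-Lip) FROM (β) + CHART LETTERS** — BOTH (W-Lip) clauses of ✓p822302 (hence REG′ ×4) FROM: the frame; the ROW-PREFIX (β) texts at level `Ts` for `ρ_Ts` (bound `Bρ`) and
`ρ′_Ts` (bound `Bρ′`), radius `rA·(49∕50·θ_Ts)`; (Φ-disp-Lip) (`D`, every level `j < n ≤ Ts`); (J-Lip) (`KJ`); and LOCAL bondwise exponential increments of the fine curves
`s ↦ Φ (X s, z)` ∕ `s ↦ Φ (X s s′, z)` on `Ioo (-1) 2` (pairs at distance `≤ δ`; speeds `k ≥ 0`, `Σ k ≤ K`; rows `k e·δ ≤ μ`, `4·(√3·μ) ≤ θ_Ts∕50`, `μ < rA·(49∕50·θ_Ts)`). [folklore] -/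
theorem weightLip_of_beta_of_chartLetters (F : T3Family) (γ b₀ p₀ : ℝ) (j Ts : ℕ) (hjTs : j + 1 ≤ Ts)
    (ρ ρ' : (i : ℕ) → GaugeField (F.P i) 0 ↥(Matrix.specialUnitaryGroup (Fin 2) ℂ) → ℝ)
    (hρc : ContinuousOn (ρ Ts) {U | PlaqSmall (θBal F.L γ b₀ p₀ Ts) U}) (hρ'c : ContinuousOn (ρ' Ts) {U | PlaqSmall (θBal F.L γ b₀ p₀ Ts) U})
    (hρpos : ∀ U, PlaqSmall (θBal F.L γ b₀ p₀ Ts) U → 0 < ρ Ts U ∧ 0 < ρ' Ts U) (hθ : ∀ n, 0 < θBal F.L γ b₀ p₀ n)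
    (hχsupp : ∀ U, mwCut F γ b₀ p₀ j Ts U ≠ 0 → ∀ (n : ℕ) (hjn : j + 1 ≤ n) (hnK : n ≤ Ts), PlaqSmall (24 / 25 * θBal F.L γ b₀ p₀ n) (descendTo F ℰp n Ts hnK U))
    (rA Bρ Bρ' : ℝ) (hrA : 0 < rA)
    (hβ : ∀ (U : GaugeField (F.P Ts) 0 ↥(Matrix.specialUnitaryGroup (Fin 2) ℂ)), PlaqSmall (49 / 50 * θBal F.L γ b₀ p₀ Ts) U →
      ∀ (b b' : PBond (F.P Ts) 0) (v v' : Fin 3 → ℝ), ‖v‖ ≤ 1 → ‖v'‖ ≤ 1 →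
        ∃ g : ℂ × ℂ → ℂ, DifferentiableOn ℂ g (Metric.ball (0 : ℂ) (rA * (49 / 50 * θBal F.L γ b₀ p₀ Ts)) ×ˢ Metric.ball (0 : ℂ) (rA * (49 / 50 * θBal F.L γ b₀ p₀ Ts))) ∧
          (∀ (s t : ℝ) (V Z : GaugeField (F.P Ts) 0 ↥(Matrix.specialUnitaryGroup (Fin 2) ℂ)), |s| < rA * (49 / 50 * θBal F.L γ b₀ p₀ Ts) → |t| < rA * (49 / 50 * θBal F.L γ b₀ p₀ Ts) →
            (∀ e, e ≠ b → V e = U e) → V b = U b * expPt (s • v) → (∀ e, e ≠ b' → Z e = V e) → Z b' = V b' * expPt (t • v') →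
            g ((s : ℂ), (t : ℂ)) = (((Real.log (ρ Ts Z)) : ℝ) : ℂ)) ∧
          ∀ z ∈ Metric.ball (0 : ℂ) (rA * (49 / 50 * θBal F.L γ b₀ p₀ Ts)) ×ˢ Metric.ball (0 : ℂ) (rA * (49 / 50 * θBal F.L γ b₀ p₀ Ts)), ‖g z - g 0‖ ≤ Bρ)
    (hβ' : ∀ (U : GaugeField (F.P Ts) 0 ↥(Matrix.specialUnitaryGroup (Fin 2) ℂ)), PlaqSmall (49 / 50 * θBal F.L γ b₀ p₀ Ts) U →
      ∀ (b b' : PBond (F.P Ts) 0) (v v' : Fin 3 → ℝ), ‖v‖ ≤ 1 → ‖v'‖ ≤ 1 →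
        ∃ g : ℂ × ℂ → ℂ, DifferentiableOn ℂ g (Metric.ball (0 : ℂ) (rA * (49 / 50 * θBal F.L γ b₀ p₀ Ts)) ×ˢ Metric.ball (0 : ℂ) (rA * (49 / 50 * θBal F.L γ b₀ p₀ Ts))) ∧
          (∀ (s t : ℝ) (V Z : GaugeField (F.P Ts) 0 ↥(Matrix.specialUnitaryGroup (Fin 2) ℂ)), |s| < rA * (49 / 50 * θBal F.L γ b₀ p₀ Ts) → |t| < rA * (49 / 50 * θBal F.L γ b₀ p₀ Ts) →
            (∀ e, e ≠ b → V e = U e) → V b = U b * expPt (s • v) → (∀ e, e ≠ b' → Z e = V e) → Z b' = V b' * expPt (t • v') →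
            g ((s : ℂ), (t : ℂ)) = (((Real.log (ρ' Ts Z)) : ℝ) : ℂ)) ∧
          ∀ z ∈ Metric.ball (0 : ℂ) (rA * (49 / 50 * θBal F.L γ b₀ p₀ Ts)) ×ˢ Metric.ball (0 : ℂ) (rA * (49 / 50 * θBal F.L γ b₀ p₀ Ts)), ‖g z - g 0‖ ≤ Bρ')
    {Z : Type} [MeasurableSpace Z] (τ : Measure Z)
    (Φ : GaugeField (F.P j) 0 ↥(Matrix.specialUnitaryGroup (Fin 2) ℂ) × Z → GaugeField (F.P Ts) 0 ↥(Matrix.specialUnitaryGroup (Fin 2) ℂ))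
    (J : GaugeField (F.P j) 0 ↥(Matrix.specialUnitaryGroup (Fin 2) ℂ) × Z → ℝ≥0) (CJ : ℝ) (hJle : ∀ V z, (J (V, z) : ℝ) ≤ CJ)
    (rc : ℝ) (D KJ : ℝ≥0) {μ K δ : ℝ} (hδ : 0 < δ) (k : PBond (F.P Ts) 0 → ℝ) (hk0 : ∀ e, 0 ≤ k e) (hK : ∑ e, k e ≤ K) (hkμ : ∀ e, k e * δ ≤ μ)
    (hwin : 4 * (Real.sqrt 3 * μ) ≤ θBal F.L γ b₀ p₀ Ts / 50) (hrad : μ < rA * (49 / 50 * θBal F.L γ b₀ p₀ Ts))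
    (hPdisp : ∀ (B' : PBond (F.P j) 0) (m' : Fin 3 → ℝ) (U₂ : GaugeField (F.P j) 0 ↥(Matrix.specialUnitaryGroup (Fin 2) ℂ))
      (X : ℝ → GaugeField (F.P j) 0 ↥(Matrix.specialUnitaryGroup (Fin 2) ℂ)), ‖m'‖ ≤ rc * (θBal F.L γ b₀ p₀ j / 4) → PlaqSmall (θBal F.L γ b₀ p₀ j / 4) U₂ →
      (∀ s e, e ≠ B' → X s e = U₂ e) → (∀ s, X s B' = U₂ B' * expPt (s • m')) → ∀ (z : Z) (n : ℕ) (hjn : j + 1 ≤ n) (hnT : n ≤ Ts) (p : Plaq (F.P n) 0),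
        LipschitzOnWith D (fun s => dist1 (GaugeField.plaqHol (descendTo F ℰp n Ts hnT (Φ (X s, z))) p)) (Set.Ioo (-1) 2))
    (hPincr : ∀ (B' : PBond (F.P j) 0) (m' : Fin 3 → ℝ) (U₂ : GaugeField (F.P j) 0 ↥(Matrix.specialUnitaryGroup (Fin 2) ℂ))
      (X : ℝ → GaugeField (F.P j) 0 ↥(Matrix.specialUnitaryGroup (Fin 2) ℂ)), ‖m'‖ ≤ rc * (θBal F.L γ b₀ p₀ j / 4) → PlaqSmall (θBal F.L γ b₀ p₀ j / 4) U₂ →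
      (∀ s e, e ≠ B' → X s e = U₂ e) → (∀ s, X s B' = U₂ B' * expPt (s • m')) → ∀ (z : Z),
        ∀ s ∈ Set.Ioo (-1 : ℝ) 2, ∀ s' ∈ Set.Ioo (-1 : ℝ) 2, |s - s'| ≤ δ →
          ∀ e, ∃ w : Fin 3 → ℝ, Φ (X s', z) e = Φ (X s, z) e * expPt w ∧ ‖w‖ ≤ k e * |s - s'|)
    (hPJ : ∀ (B' : PBond (F.P j) 0) (m' : Fin 3 → ℝ) (U₂ : GaugeField (F.P j) 0 ↥(Matrix.specialUnitaryGroup (Fin 2) ℂ))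
      (X : ℝ → GaugeField (F.P j) 0 ↥(Matrix.specialUnitaryGroup (Fin 2) ℂ)), ‖m'‖ ≤ rc * (θBal F.L γ b₀ p₀ j / 4) → PlaqSmall (θBal F.L γ b₀ p₀ j / 4) U₂ →
      (∀ s e, e ≠ B' → X s e = U₂ e) → (∀ s, X s B' = U₂ B' * expPt (s • m')) → ∀ z : Z,
        LipschitzOnWith KJ (fun s => (J (X s, z) : ℝ)) (Set.Ioo (-1) 2))
    (hSdisp : ∀ (B B' : PBond (F.P j) 0) (m m' : Fin 3 → ℝ) (V00 : GaugeField (F.P j) 0 ↥(Matrix.specialUnitaryGroup (Fin 2) ℂ))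
      (Y : ℝ → GaugeField (F.P j) 0 ↥(Matrix.specialUnitaryGroup (Fin 2) ℂ)) (X : ℝ → ℝ → GaugeField (F.P j) 0 ↥(Matrix.specialUnitaryGroup (Fin 2) ℂ)),
      ‖m‖ ≤ rc * (θBal F.L γ b₀ p₀ j / 4) → ‖m'‖ ≤ rc * (θBal F.L γ b₀ p₀ j / 4) → PlaqSmall (θBal F.L γ b₀ p₀ j / 4) V00 →
      (∀ s e, e ≠ B → Y s e = V00 e) → (∀ s, Y s B = V00 B * expPt (s • m)) → (∀ s s' e, e ≠ B' → X s s' e = Y s e) → (∀ s s', X s s' B' = Y s B' * expPt (s' • m')) →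
      ∀ s' ∈ Set.Icc (0:ℝ) 1, ∀ (z : Z) (n : ℕ) (hjn : j + 1 ≤ n) (hnT : n ≤ Ts) (p : Plaq (F.P n) 0),
        LipschitzOnWith D (fun s => dist1 (GaugeField.plaqHol (descendTo F ℰp n Ts hnT (Φ (X s s', z))) p)) (Set.Ioo (-1) 2))
    (hSincr : ∀ (B B' : PBond (F.P j) 0) (m m' : Fin 3 → ℝ) (V00 : GaugeField (F.P j) 0 ↥(Matrix.specialUnitaryGroup (Fin 2) ℂ))
      (Y : ℝ → GaugeField (F.P j) 0 ↥(Matrix.specialUnitaryGroup (Fin 2) ℂ)) (X : ℝ → ℝ → GaugeField (F.P j) 0 ↥(Matrix.specialUnitaryGroup (Fin 2) ℂ)),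
      ‖m‖ ≤ rc * (θBal F.L γ b₀ p₀ j / 4) → ‖m'‖ ≤ rc * (θBal F.L γ b₀ p₀ j / 4) → PlaqSmall (θBal F.L γ b₀ p₀ j / 4) V00 →
      (∀ s e, e ≠ B → Y s e = V00 e) → (∀ s, Y s B = V00 B * expPt (s • m)) → (∀ s s' e, e ≠ B' → X s s' e = Y s e) → (∀ s s', X s s' B' = Y s B' * expPt (s' • m')) →
      ∀ s' ∈ Set.Icc (0:ℝ) 1, ∀ (z : Z), ∀ s ∈ Set.Ioo (-1 : ℝ) 2, ∀ s'' ∈ Set.Ioo (-1 : ℝ) 2, |s - s''| ≤ δ →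
        ∀ e, ∃ w : Fin 3 → ℝ, Φ (X s'' s', z) e = Φ (X s s', z) e * expPt w ∧ ‖w‖ ≤ k e * |s - s''|)
    (hSJ : ∀ (B B' : PBond (F.P j) 0) (m m' : Fin 3 → ℝ) (V00 : GaugeField (F.P j) 0 ↥(Matrix.specialUnitaryGroup (Fin 2) ℂ))
      (Y : ℝ → GaugeField (F.P j) 0 ↥(Matrix.specialUnitaryGroup (Fin 2) ℂ)) (X : ℝ → ℝ → GaugeField (F.P j) 0 ↥(Matrix.specialUnitaryGroup (Fin 2) ℂ)),
      ‖m‖ ≤ rc * (θBal F.L γ b₀ p₀ j / 4) → ‖m'‖ ≤ rc * (θBal F.L γ b₀ p₀ j / 4) → PlaqSmall (θBal F.L γ b₀ p₀ j / 4) V00 →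
      (∀ s e, e ≠ B → Y s e = V00 e) → (∀ s, Y s B = V00 B * expPt (s • m)) → (∀ s s' e, e ≠ B' → X s s' e = Y s e) → (∀ s s', X s s' B' = Y s B' * expPt (s' • m')) →
      ∀ s' ∈ Set.Icc (0:ℝ) 1, ∀ z : Z, LipschitzOnWith KJ (fun s => (J (X s s', z) : ℝ)) (Set.Ioo (-1) 2)) :
    ∃ bW : ℝ, ∀ t : ℝ, 0 ≤ t → t ≤ 1 →
      (∀ (B' : PBond (F.P j) 0) (m' : Fin 3 → ℝ) (U₂ : GaugeField (F.P j) 0 ↥(Matrix.specialUnitaryGroup (Fin 2) ℂ))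
        (X : ℝ → GaugeField (F.P j) 0 ↥(Matrix.specialUnitaryGroup (Fin 2) ℂ)), ‖m'‖ ≤ rc * (θBal F.L γ b₀ p₀ j / 4) → PlaqSmall (θBal F.L γ b₀ p₀ j / 4) U₂ →
        (∀ s e, e ≠ B' → X s e = U₂ e) → (∀ s, X s B' = U₂ B' * expPt (s • m')) →
        ∀ᵐ z ∂τ, LipschitzOnWith (Real.nnabs bW) (fun s => wNum F γ b₀ p₀ j Ts ρ ρ' Φ J t (X s) z) (Set.Ioo (-1) 2)) ∧
      (∀ (B B' : PBond (F.P j) 0) (m m' : Fin 3 → ℝ) (V00 : GaugeField (F.P j) 0 ↥(Matrix.specialUnitaryGroup (Fin 2) ℂ))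
        (Y : ℝ → GaugeField (F.P j) 0 ↥(Matrix.specialUnitaryGroup (Fin 2) ℂ)) (X : ℝ → ℝ → GaugeField (F.P j) 0 ↥(Matrix.specialUnitaryGroup (Fin 2) ℂ)),
        ‖m‖ ≤ rc * (θBal F.L γ b₀ p₀ j / 4) → ‖m'‖ ≤ rc * (θBal F.L γ b₀ p₀ j / 4) → PlaqSmall (θBal F.L γ b₀ p₀ j / 4) V00 →
        (∀ s e, e ≠ B → Y s e = V00 e) → (∀ s, Y s B = V00 B * expPt (s • m)) → (∀ s s' e, e ≠ B' → X s s' e = Y s e) → (∀ s s', X s s' B' = Y s B' * expPt (s' • m')) →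
        ∀ s' ∈ Set.Icc (0:ℝ) 1, ∀ᵐ z ∂τ, LipschitzOnWith (Real.nnabs bW) (fun s => wNum F γ b₀ p₀ j Ts ρ ρ' Φ J t (X s s') z) (Set.Ioo (-1) 2)) := by
  have hθT := hθ Ts
  refine weightLip_of_chartLetters_seg F γ b₀ p₀ j Ts hjTs ρ ρ' hρc hρ'c hρpos hθ hχsupp τ Φ J CJ hJle rc D
    (Real.toNNReal ((Bρ / rA) * (K / (49 / 50 * θBal F.L γ b₀ p₀ Ts)))) (Real.toNNReal ((Bρ' / rA) * (K / (49 / 50 * θBal F.L γ b₀ p₀ Ts)))) KJ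
    hPdisp (fun B' m' U₂ X hm' hU₂ hoff hon z => ⟨?_, ?_⟩) hPJ hSdisp (fun B B' m m' V00 Y X hm hm' hV hYoff hYon hXoff hXon s' hs' z => ⟨?_, ?_⟩) hSJ
  · exact logDensity_segLip_of_beta F γ b₀ p₀ j Ts (ρ Ts) rA Bρ hrA hθT hβ Φ X z hδ k hk0 hK hkμ (hPincr B' m' U₂ X hm' hU₂ hoff hon z) hwin hrad
  · exact logDensity_segLip_of_beta F γ b₀ p₀ j Ts (ρ' Ts) rA Bρ' hrA hθT hβ' Φ X z hδ k hk0 hK hkμ (hPincr B' m' U₂ X hm' hU₂ hoff hon z) hwin hrad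
  · exact logDensity_segLip_of_beta F γ b₀ p₀ j Ts (ρ Ts) rA Bρ hrA hθT hβ Φ (fun s => X s s') z hδ k hk0 hK hkμ
      (hSincr B B' m m' V00 Y X hm hm' hV hYoff hYon hXoff hXon s' hs' z) hwin hrad
  · exact logDensity_segLip_of_beta F γ b₀ p₀ j Ts (ρ' Ts) rA Bρ' hrA hθT hβ' Φ (fun s => X s s') z hδ k hk0 hK hkμ
      (hSincr B B' m m' V00 Y X hm hm' hV hYoff hYon hXoff hXon s' hs' z) hwin hrad

end E2E

end Summit.QuantumFields.YangMills.Theorems.OrganTangentWeightLipOfChartLettersSeg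

end
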